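import Summits.QuantumFields.YangMills.Theorems.FluctuationComparisonRegPrIntLS2BetaFaceLayerCounts
import Summits.QuantumFields.YangMills.Theorems.FluctuationComparisonRegPrIntLS2BetaPreimagesOfFaceSpreads
import HarnessLib

/-!
# S2β ∕ GAP♯∘ strata residue, (RINV-curl) brick (B5) — THE FACE CURL COUNT: `Σ_p ‖(curl_{U₀} X^{+μ}_B w)_p‖ ≤ 4(d−1)·(N^{d−2} + (θ₀ + δ_I)·N^{d−1})·‖w‖`
# for the face spread of ANY transporter `H` whose interior cycles are `δ_I`-thin (generic `P : Params`, `N = L^k`; DEFINITION-FREE)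

Cell `ym3-torus` (YM ladder rung R3 = continuum `SU(2)` Yang–Mills on the three-torus — a RUNG: NOT d = 4, NOT infinite volume,
NOT a mass gap, NOT Clay).  Width seat «width 16» `ym3-torus-px16` (gen 22), FREE px helper on crux `stmt-QuantumFields-20520`
(`FluctuationComparisonRegPrIntL`), count-neutral, DEFINITION-FREE (0 `def`, 0 `instance`, 0 `notation`, 0 `sorry`), default heartbeats.

WHAT.  Input (iii) of the (RINV-curl) door ✓`…S2BetaPreimagesOfFaceSpreads.exists_preimage_curl_of_faceSpreads` for the FACE SPREAD of the face-preimage road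
(UV3-NODE §75.11): at a background `U₀ : GaugeField P 0 SU(2)`, a coarse bond `⟨x, μ⟩` of level `k` (`k + 1 ≤ m + K`) and ANY transporter `H : T_η → SU(2)`,
  `X^{+μ}_B w (b) := Ad_{H(b₋)⁻¹} w` on the bonds `b` from `B^k(x)` to `B^k(x + e_μ)` (the `μ`-bonds of the outgoing `μ`-layer, ✓`…FaceLayerCounts.face_iff`), `0` elsewhere.
If every plaquette of `U₀` is within `θ₀` of `1` and every INTERIOR CYCLE of `H` in the block is `δ_I`-thin
(`dist1 (H z · U₀⟨z, κ⟩ · H(z + e_κ)⁻¹) ≤ δ_I` whenever `z, z + e_κ ∈ B^k(x)` — (B4b), px13 g25's ✓∕⧗`…S2BetaCombTransporter.dist1_comb_cycle_le` for the comb), then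
  ★★★ `faceSpread_curlCount_le`:  `Σ_p ‖(curl_{U₀} X^{+μ}_B w)_p‖ ≤ 4(d−1)·((L^k)^{d−2} + (θ₀ + δ_I)·(L^k)^{d−1})·‖w‖`
(the curl expression of ✓`…S2BetaCritPairOfMultiplier.abs_firstVariation_le_curl` VERBATIM).  At `d = 3` with BKG `θ₀ = C₁θ_J N⁻²` and `δ_I ≤ N·θ₀` this is
`≤ 8(1 + 2C₁θ_J)·N·‖w‖` — the `C = O(N)` the door turns into `C_R·L^{K−J}`.
HOW.  §1 `norm_adSU2_sub_adSU2_le`: `‖Ad_a X − Ad_b X‖ ≤ 2·dist1(a⁻¹b)·‖X‖` (unit quaternions).  §2 the PLAQUETTE-WISE bound `norm_curl_faceSpread_le`: a plaquette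
sees the face spread only through its two `μ`-edges `⟨s, μ⟩`, `⟨s + e_κ, μ⟩`; with both on the layer the two transports differ by (a conjugate of) the plaquette times
the interior cycle of `⟨s, κ⟩` (cost `2(θ₀ + δ_I)‖w‖`), with one on the layer the cost is `‖w‖` (PERIMETER), with none `0`.  §3 the COUNT: reindex by `(s, κ)`
(`κ ≠ μ`; an injection, factor `2` for the two orientations `κ ≷ μ`) and use ✓`…FaceLayerCounts.card_layer_le` ∕ `card_perimeter_out_le` ∕ `card_perimeter_in_le`.

HONEST SCOPE.  Lattice bookkeeping + the triangle inequality in `SU(2)`; (B4b) is a HYPOTHESIS here (`hW`); nothing of Bałaban's analysis is asserted; (D2), (RINV-curl),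
MULT♮, AVG₂♭-ax, «CRIT-ax», (D-ax), GAP♯∘ (`stub_uniformFibreGapOrbit`; registry `Lines/semiclassical_s2beta.lean` 3732b7df UNTOUCHED), the five registered stubs,
S2β, crux 20520, 19936, 19200 and `YM3TorusSU2` are NOT proved; no registered stub is closed; the Yang–Mills mass gap is NOT proved.  Sorry-free, axioms standard.

References: T. Bałaban, CMP **98** (1985) 17–51 [Balaban1985Averaging] ((9) p.19 plaquette variables; (125) p.36, Sect. D pp.39–40 the right inverse of the
linearised averaging); CMP **102** (1985) 277–309 [Balaban1985Variational] ((34) p.283, the covariant curl); CMP **122** (1989) 175–202 [Balaban1989LargeFieldI]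
((1.77) p.194, `Ad`).
-/

set_option autoImplicit false

noncomputable section

open scoped Quaternion
open Finset Function
open Literature.MathematicalPhysics.QuantumLattice (su2Quat norm_su2Quat su2Quat_ne_zero)
open Literature.MathematicalPhysics.QuantumFieldTheory.Balaban1983to89
open Literature.MathematicalPhysics.QuantumFieldTheory.Balaban1983to89.T4CubeChartGnomonic (SU2)
open Literature.MathematicalPhysics.QuantumFieldTheory.Balaban1983to89.T4HaarSU2ExpChart (imQuat norm_imQuat)
open Literature.MathematicalPhysics.QuantumFieldTheory.Balaban1983to89.T4ExpWindowSmallField (dist1_eq_norm_su2Quat_sub_one)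
open Literature.MathematicalPhysics.QuantumFieldTheory.Balaban1983to89.B15Prop1ChartSU2 (adSU2)
open Literature.MathematicalPhysics.QuantumFieldTheory.Balaban1983to89.B15Prop1ChartCalculusSU2 (imQuat_adSU2 adSU2_adSU2)
open Literature.MathematicalPhysics.QuantumFieldTheory.Balaban1983to89.B14.Eq22Determines (blockIter)
open Summit.QuantumFields.YangMills.Theorems.FluctuationComparisonRegPrIntLS2BetaCritPairOfMultiplier (norm_adSU2_le)
open Summit.QuantumFields.YangMills.Theorems.FluctuationComparisonRegPrIntLS2BetaFaceLayerCounts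

namespace Summit.QuantumFields.YangMills.Theorems.FluctuationComparisonRegPrIntLS2BetaFaceSpreadCurlCount

/-! ## §1 Two adjoint rotations differ by at most twice the distance of their quotient from `1` -/

/-- ★ `‖Ad_a X − Ad_b X‖ ≤ 2·dist1(a⁻¹·b)·‖X‖` (`Ad_a` is an isometry; `q·ιX·q⁻¹ − ιX = (q − 1)·ιX·q⁻¹ + ιX·(q⁻¹ − 1)` for the unit quaternion `q` of `a⁻¹b`,
`‖q − 1‖ = dist1`). [cite: Balaban1989LargeFieldI, (1.77) p.194] -/
theorem norm_adSU2_sub_adSU2_le (a b : SU2) (X : EuclideanSpace ℝ (Fin 3)) : ‖adSU2 a X - adSU2 b X‖ ≤ 2 * dist1 (a⁻¹ * b) * ‖X‖ := by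
  -- the core estimate `‖Ad_g Y − Y‖ ≤ 2·dist1 g·‖Y‖`
  have core : ∀ (g : SU2) (Y : EuclideanSpace ℝ (Fin 3)), ‖adSU2 g Y - Y‖ ≤ 2 * dist1 g * ‖Y‖ := by
    intro g Y
    set q := su2Quat g with hq
    have hq1 : ‖q‖ = 1 := norm_su2Quat g
    have hq0 : q ≠ 0 := su2Quat_ne_zero g
    have hqi : ‖q⁻¹‖ = 1 := by rw [norm_inv, hq1, inv_one]
    have hqi1 : ‖q⁻¹ - 1‖ = ‖q - 1‖ := by
      have : q⁻¹ - 1 = q⁻¹ * (1 - q) := by rw [mul_sub, mul_one, inv_mul_cancel₀ hq0]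
      rw [this, norm_mul, hqi, one_mul, norm_sub_rev]
    have h1 : ‖adSU2 g Y - Y‖ = ‖imQuat (adSU2 g Y) - imQuat Y‖ := by rw [← map_sub, norm_imQuat]
    rw [h1, imQuat_adSU2, ← hq]
    have hsplit : q * imQuat Y * q⁻¹ - imQuat Y = (q - 1) * imQuat Y * q⁻¹ + imQuat Y * (q⁻¹ - 1) := by
      rw [sub_mul, sub_mul, one_mul, mul_sub, mul_one]; abel
    rw [hsplit, dist1_eq_norm_su2Quat_sub_one, ← hq]
    calc ‖(q - 1) * imQuat Y * q⁻¹ + imQuat Y * (q⁻¹ - 1)‖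
        ≤ ‖q - 1‖ * ‖imQuat Y‖ * ‖q⁻¹‖ + ‖imQuat Y‖ * ‖q⁻¹ - 1‖ :=
          (norm_add_le _ _).trans (add_le_add (le_of_eq (by rw [norm_mul, norm_mul])) (le_of_eq (by rw [norm_mul])))
      _ = 2 * ‖q - 1‖ * ‖Y‖ := by rw [hqi, hqi1, norm_imQuat]; ring
  have hiso : ∀ (g : SU2) (Y : EuclideanSpace ℝ (Fin 3)), ‖adSU2 g Y‖ = ‖Y‖ := by
    intro g Y
    refine le_antisymm (norm_adSU2_le g Y) ?_
    calc ‖Y‖ = ‖adSU2 g⁻¹ (adSU2 g Y)‖ := by rw [B15Prop1ChartCalculusSU2.adSU2_inv_adSU2]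
      _ ≤ ‖adSU2 g Y‖ := norm_adSU2_le _ _
  have h : adSU2 a X - adSU2 b X = adSU2 a (X - adSU2 (a⁻¹ * b) X) := by
    rw [map_sub, adSU2_adSU2, mul_inv_cancel_left]
  rw [h, hiso, norm_sub_rev]
  exact core _ _

/-! ## §2 The plaquette-wise bound -/

section Plaquette

variable {P : Params} {k : ℕ}

/-- THE TWO TRANSPORTS OF AN IN-LAYER `(μ, κ)`-PLAQUETTE (`μ` first) differ by the plaquette times the interior cycle of `⟨s, κ⟩`:
`(P⁻¹H_s⁻¹)⁻¹ · (P⁻¹·U₁U₂U₃⁻¹·H_{s+κ}⁻¹) = (H_s P H_s⁻¹)·(H_s U⟨s,κ⟩ H_{s+κ}⁻¹)`, hence within `θ₀ + δ_I` of `1`. [cite: Balaban1985Averaging, (9) p.19 (bookkeeping)] -/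
theorem dist1_transports_mu_first_le {G : Type*} [GaugeGroup G] (U₀ : GaugeField P 0 G) (H : Site P 0 → G) (s : Site P 0) {μ κ : Fin P.d}
    (hμκ : μ < κ) {θ₀ δI : ℝ}
    (hP : dist1 (GaugeField.plaqHol U₀ ⟨s, μ, κ, hμκ⟩) ≤ θ₀) (hW : dist1 (H s * U₀ ⟨s, κ⟩ * (H (s.shift κ))⁻¹) ≤ δI) :
    dist1 (((GaugeField.plaqHol U₀ ⟨s, μ, κ, hμκ⟩)⁻¹ * (H s)⁻¹)⁻¹ *
      ((GaugeField.plaqHol U₀ ⟨s, μ, κ, hμκ⟩)⁻¹ * U₀ ⟨s, μ⟩ * U₀ ⟨s.shift μ, κ⟩ * (U₀ ⟨s.shift κ, μ⟩)⁻¹ * (H (s.shift κ))⁻¹)) ≤ θ₀ + δI := by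
  have key : ((GaugeField.plaqHol U₀ ⟨s, μ, κ, hμκ⟩)⁻¹ * (H s)⁻¹)⁻¹ *
      ((GaugeField.plaqHol U₀ ⟨s, μ, κ, hμκ⟩)⁻¹ * U₀ ⟨s, μ⟩ * U₀ ⟨s.shift μ, κ⟩ * (U₀ ⟨s.shift κ, μ⟩)⁻¹ * (H (s.shift κ))⁻¹) =
      (H s * GaugeField.plaqHol U₀ ⟨s, μ, κ, hμκ⟩ * (H s)⁻¹) * (H s * U₀ ⟨s, κ⟩ * (H (s.shift κ))⁻¹) := by
    simp only [GaugeField.plaqHol]; group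
  rw [key]
  refine (GaugeGroup.dist1_mul_le _ _).trans (add_le_add ?_ hW)
  rw [GaugeGroup.dist1_conj]; exact hP

/-- THE TWO TRANSPORTS OF AN IN-LAYER `(κ, μ)`-PLAQUETTE (`μ` second): `(P⁻¹U⟨s,κ⟩H_{s+κ}⁻¹)⁻¹ · H_s⁻¹` is within `θ₀ + δ_I` of `1` (its inverse is
`(H_s P⁻¹ H_s⁻¹)·(H_s U⟨s,κ⟩ H_{s+κ}⁻¹)`). [cite: Balaban1985Averaging, (9) p.19 (bookkeeping)] -/
theorem dist1_transports_mu_second_le {G : Type*} [GaugeGroup G] (U₀ : GaugeField P 0 G) (H : Site P 0 → G) (s : Site P 0) {κ μ : Fin P.d}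
    (hκμ : κ < μ) {θ₀ δI : ℝ}
    (hP : dist1 (GaugeField.plaqHol U₀ ⟨s, κ, μ, hκμ⟩) ≤ θ₀) (hW : dist1 (H s * U₀ ⟨s, κ⟩ * (H (s.shift κ))⁻¹) ≤ δI) :
    dist1 (((GaugeField.plaqHol U₀ ⟨s, κ, μ, hκμ⟩)⁻¹ * U₀ ⟨s, κ⟩ * (H (s.shift κ))⁻¹)⁻¹ * (H s)⁻¹) ≤ θ₀ + δI := by
  have key : ((GaugeField.plaqHol U₀ ⟨s, κ, μ, hκμ⟩)⁻¹ * U₀ ⟨s, κ⟩ * (H (s.shift κ))⁻¹)⁻¹ * (H s)⁻¹ =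
      ((H s * (GaugeField.plaqHol U₀ ⟨s, κ, μ, hκμ⟩)⁻¹ * (H s)⁻¹) * (H s * U₀ ⟨s, κ⟩ * (H (s.shift κ))⁻¹))⁻¹ := by
    group
  rw [key, GaugeGroup.dist1_inv]
  refine (GaugeGroup.dist1_mul_le _ _).trans (add_le_add ?_ hW)
  rw [GaugeGroup.dist1_conj, GaugeGroup.dist1_inv]; exact hP

set_option maxHeartbeats 400000 in
/-- ★★ **THE PLAQUETTE-WISE BOUND ON THE COVARIANT CURL OF THE FACE SPREAD.**  With the layer predicate `Λ s :≡ (B^k s = x ∧ B^k(s + e_μ) ≠ x)` and, for a direction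
`κ`, the weight `g(s, κ) := Λ s ? (Λ(s+e_κ) ? 2(θ₀ + δ_I)‖w‖ : ‖w‖) : (Λ(s+e_κ) ? ‖w‖ : 0)`, the plaquette `p = (s, μ′, ν′)` has
`‖(curl_{U₀} X^{+μ}_B w)_p‖ ≤ [μ′ = μ]·g(s, ν′) + [ν′ = μ]·g(s, μ′)` (IN-LAYER: one plaquette and one interior cycle; PERIMETER: one isometric transport; else `0`).
[cite: Balaban1985Variational, (34) p.283; Balaban1985Averaging, (9) p.19] -/
theorem norm_curl_faceSpread_le (hk : k + 1 ≤ P.m + P.K) (U₀ : GaugeField P 0 SU2) (H : Site P 0 → SU2) (x : Site P k) (μ : Fin P.d)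
    {θ₀ δI : ℝ} (hU : ∀ q : Plaq P 0, dist1 (GaugeField.plaqHol U₀ q) ≤ θ₀)
    (hW : ∀ (z : Site P 0) (κ : Fin P.d), blockIter k z = x → blockIter k (z.shift κ) = x → dist1 (H z * U₀ ⟨z, κ⟩ * (H (z.shift κ))⁻¹) ≤ δI)
    (w : EuclideanSpace ℝ (Fin 3)) (X : PBond P 0 → EuclideanSpace ℝ (Fin 3))
    (hX : ∀ b : PBond P 0, X b = if blockIter k b.src = x ∧ blockIter k b.tgt = x.shift μ then adSU2 (H b.src)⁻¹ w else 0) (p : Plaq P 0) :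
    ‖adSU2 (GaugeField.plaqHol U₀ p)⁻¹ (X ⟨p.src, p.μ⟩) + adSU2 ((GaugeField.plaqHol U₀ p)⁻¹ * U₀ ⟨p.src, p.μ⟩) (X ⟨p.src.shift p.μ, p.ν⟩) -
        adSU2 ((GaugeField.plaqHol U₀ p)⁻¹ * U₀ ⟨p.src, p.μ⟩ * U₀ ⟨p.src.shift p.μ, p.ν⟩ * (U₀ ⟨p.src.shift p.ν, p.μ⟩)⁻¹) (X ⟨p.src.shift p.ν, p.μ⟩) -
        X ⟨p.src, p.ν⟩‖ ≤
      (if p.μ = μ then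
        (if blockIter k p.src = x ∧ blockIter k (p.src.shift μ) ≠ x then
          (if blockIter k (p.src.shift p.ν) = x ∧ blockIter k ((p.src.shift p.ν).shift μ) ≠ x then 2 * (θ₀ + δI) * ‖w‖ else ‖w‖)
         else (if blockIter k (p.src.shift p.ν) = x ∧ blockIter k ((p.src.shift p.ν).shift μ) ≠ x then ‖w‖ else 0))
       else 0) +
      (if p.ν = μ then
        (if blockIter k p.src = x ∧ blockIter k (p.src.shift μ) ≠ x then
          (if blockIter k (p.src.shift p.μ) = x ∧ blockIter k ((p.src.shift p.μ).shift μ) ≠ x then 2 * (θ₀ + δI) * ‖w‖ else ‖w‖)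
         else (if blockIter k (p.src.shift p.μ) = x ∧ blockIter k ((p.src.shift p.μ).shift μ) ≠ x then ‖w‖ else 0))
       else 0) := by
  have hk' : k ≤ P.m + P.K := Nat.le_of_succ_le hk
  -- the face spread on a bond `⟨z, ν⟩`: `Ad_{H z⁻¹} w` iff `ν = μ` and `z` is on the layer
  have hXv : ∀ (z : Site P 0) (ν : Fin P.d),
      X ⟨z, ν⟩ = if ν = μ ∧ (blockIter k z = x ∧ blockIter k (z.shift μ) ≠ x) then adSU2 (H z)⁻¹ w else 0 := by
    intro z ν
    rw [hX]
    by_cases h : blockIter k z = x ∧ blockIter k (PBond.tgt ⟨z, ν⟩) = x.shift μ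
    · rw [if_pos h, if_pos (by have := (face_iff hk' x μ ⟨z, ν⟩).1 h; exact ⟨this.1, this.2⟩)]
    · rw [if_neg h, if_neg (fun h' => h ((face_iff hk' x μ ⟨z, ν⟩).2 ⟨h'.1, h'.2⟩))]
  have hiso : ∀ (g : SU2) (Y : EuclideanSpace ℝ (Fin 3)), ‖adSU2 g Y‖ = ‖Y‖ := by
    intro g Y
    refine le_antisymm (norm_adSU2_le g Y) ?_
    calc ‖Y‖ = ‖adSU2 g⁻¹ (adSU2 g Y)‖ := by rw [B15Prop1ChartCalculusSU2.adSU2_inv_adSU2]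
      _ ≤ ‖adSU2 g Y‖ := norm_adSU2_le _ _
  obtain ⟨s, μ', ν', hlt⟩ := p
  simp only
  by_cases h1 : μ' = μ
  · -- `μ` is the FIRST axis of the plaquette; `ν' ≠ μ`
    subst h1
    have hν : ν' ≠ μ' := ne_of_gt hlt
    rw [if_pos rfl, if_neg hν, add_zero]
    rw [hXv s μ', hXv (s.shift μ') ν', hXv (s.shift ν') μ', hXv s ν']
    simp only [hν, false_and, if_false, map_zero, add_zero, sub_zero, true_and]
    by_cases hs : blockIter k s = x ∧ blockIter k (s.shift μ') ≠ x
    · rw [if_pos hs, if_pos hs]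
      by_cases ht : blockIter k (s.shift ν') = x ∧ blockIter k ((s.shift ν').shift μ') ≠ x
      · -- both `μ`-edges on the layer: one plaquette and one interior cycle
        rw [if_pos ht, if_pos ht, adSU2_adSU2, adSU2_adSU2]
        refine (norm_adSU2_sub_adSU2_le _ _ w).trans ?_
        have hd := dist1_transports_mu_first_le U₀ H s hlt (hU ⟨s, μ', ν', hlt⟩) (hW s ν' hs.1 ht.1)
        exact mul_le_mul_of_nonneg_right (by linarith) (norm_nonneg w)
      · -- outward perimeter
        rw [if_neg ht, if_neg ht, map_zero, sub_zero, hiso, hiso]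
    · rw [if_neg hs, if_neg hs]
      by_cases ht : blockIter k (s.shift ν') = x ∧ blockIter k ((s.shift ν').shift μ') ≠ x
      · -- inward perimeter
        rw [if_pos ht, if_pos ht, map_zero, zero_sub, norm_neg, hiso, hiso]
      · rw [if_neg ht, if_neg ht]; simp
  · rw [if_neg h1, zero_add]
    by_cases h2 : ν' = μ
    · -- `μ` is the SECOND axis of the plaquette; `μ' ≠ μ`
      subst h2
      rw [if_pos rfl]
      rw [hXv s μ', hXv (s.shift μ') ν', hXv (s.shift ν') μ', hXv s ν']
      simp only [h1, false_and, if_false, map_zero, zero_add, sub_zero, true_and]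
      by_cases hs : blockIter k s = x ∧ blockIter k (s.shift ν') ≠ x
      · rw [if_pos hs, if_pos hs]
        by_cases ht : blockIter k (s.shift μ') = x ∧ blockIter k ((s.shift μ').shift ν') ≠ x
        · rw [if_pos ht, if_pos ht, adSU2_adSU2]
          refine (norm_adSU2_sub_adSU2_le _ _ w).trans ?_
          have hd := dist1_transports_mu_second_le U₀ H s hlt (hU ⟨s, μ', ν', hlt⟩) (hW s μ' hs.1 ht.1)
          exact mul_le_mul_of_nonneg_right (by linarith) (norm_nonneg w)
        · rw [if_neg ht, if_neg ht, map_zero, zero_sub, norm_neg, hiso]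
      · rw [if_neg hs, if_neg hs]
        by_cases ht : blockIter k (s.shift μ') = x ∧ blockIter k ((s.shift μ').shift ν') ≠ x
        · rw [if_pos ht, if_pos ht, sub_zero, hiso, hiso]
        · rw [if_neg ht, if_neg ht]; simp
    · -- the plaquette does not contain the direction `μ`: it sees nothing
      rw [if_neg h2]
      rw [hXv s μ', hXv (s.shift μ') ν', hXv (s.shift ν') μ', hXv s ν']
      simp [h1, h2]

/-- The weight `g(s, κ)` is dominated by three indicators: `[Λ s]·2(θ₀ + δ_I)‖w‖ + [Λ s ∧ ¬Λ(s+e_κ)]·‖w‖ + [¬Λ s ∧ Λ(s+e_κ)]·‖w‖`. [folklore] -/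
theorem weight_le_indicators (A B : Prop) [Decidable A] [Decidable B] {a : ℝ} (c : ℝ) (ha : 0 ≤ a) :
    (if A then (if B then a else c) else (if B then c else 0)) ≤
      (if A then a else 0) + (if A ∧ ¬ B then c else 0) + (if ¬ A ∧ B then c else 0) := by
  by_cases hA : A <;> by_cases hB : B <;> simp [hA, hB, ha]

end Plaquette

/-! ## §3 The count -/

section Count

variable {P : Params} {k : ℕ}

/-- Summing an indicator: `Σ_s [Q s]·c = c·#{s | Q s}`. [folklore] -/
theorem sum_ite_const_eq_card_mul (Q : Site P 0 → Prop) [DecidablePred Q] (c : ℝ) :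
    ∑ s : Site P 0, (if Q s then c else 0) = c * ((univ.filter Q).card : ℝ) := by
  rw [← Finset.sum_filter, Finset.sum_const, nsmul_eq_mul, mul_comm]

set_option maxHeartbeats 400000 in
/-- ★★★ **THE FACE CURL COUNT** (input (iii) of the (RINV-curl) door for the face spread of a `δ_I`-thin transporter):
`Σ_p ‖(curl_{U₀} X^{+μ}_B w)_p‖ ≤ 4(d−1)·((L^k)^{d−2} + (θ₀ + δ_I)·(L^k)^{d−1})·‖w‖`. [cite: Balaban1985Averaging, (125) p.36, Sect. D pp.39-40; Balaban1985Variational, (34) p.283] -/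
theorem faceSpread_curlCount_le (hk : k + 1 ≤ P.m + P.K) (U₀ : GaugeField P 0 SU2) (H : Site P 0 → SU2) (x : Site P k) (μ : Fin P.d)
    {θ₀ δI : ℝ} (hθ : 0 ≤ θ₀) (hδ : 0 ≤ δI) (hU : ∀ q : Plaq P 0, dist1 (GaugeField.plaqHol U₀ q) ≤ θ₀)
    (hW : ∀ (z : Site P 0) (κ : Fin P.d), blockIter k z = x → blockIter k (z.shift κ) = x → dist1 (H z * U₀ ⟨z, κ⟩ * (H (z.shift κ))⁻¹) ≤ δI)
    (w : EuclideanSpace ℝ (Fin 3)) (X : PBond P 0 → EuclideanSpace ℝ (Fin 3))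
    (hX : ∀ b : PBond P 0, X b = if blockIter k b.src = x ∧ blockIter k b.tgt = x.shift μ then adSU2 (H b.src)⁻¹ w else 0) :
    ∑ p : Plaq P 0, ‖adSU2 (GaugeField.plaqHol U₀ p)⁻¹ (X ⟨p.src, p.μ⟩) + adSU2 ((GaugeField.plaqHol U₀ p)⁻¹ * U₀ ⟨p.src, p.μ⟩) (X ⟨p.src.shift p.μ, p.ν⟩) -
        adSU2 ((GaugeField.plaqHol U₀ p)⁻¹ * U₀ ⟨p.src, p.μ⟩ * U₀ ⟨p.src.shift p.μ, p.ν⟩ * (U₀ ⟨p.src.shift p.ν, p.μ⟩)⁻¹) (X ⟨p.src.shift p.ν, p.μ⟩) -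
        X ⟨p.src, p.ν⟩‖ ≤
      4 * ((P.d : ℝ) - 1) * (((P.L : ℝ) ^ k) ^ (P.d - 2) + (θ₀ + δI) * ((P.L : ℝ) ^ k) ^ (P.d - 1)) * ‖w‖ := by
  classical
  have hk' : k ≤ P.m + P.K := Nat.le_of_succ_le hk
  have hw0 : 0 ≤ ‖w‖ := norm_nonneg _
  -- the site ∕ direction weight `h(s, κ)`
  have h2w : 0 ≤ 2 * (θ₀ + δI) * ‖w‖ := by positivity
  -- the site ∕ direction weight `g(s, κ)` of §2 and its indicator majorant `h(s, κ)`
  set g : Site P 0 → Fin P.d → ℝ := fun s κ =>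
    if blockIter k s = x ∧ blockIter k (s.shift μ) ≠ x then
      (if blockIter k (s.shift κ) = x ∧ blockIter k ((s.shift κ).shift μ) ≠ x then 2 * (θ₀ + δI) * ‖w‖ else ‖w‖)
    else (if blockIter k (s.shift κ) = x ∧ blockIter k ((s.shift κ).shift μ) ≠ x then ‖w‖ else 0) with hg
  set h : Site P 0 → Fin P.d → ℝ := fun s κ =>
    (if blockIter k s = x ∧ blockIter k (s.shift μ) ≠ x then 2 * (θ₀ + δI) * ‖w‖ else 0) +
    (if (blockIter k s = x ∧ blockIter k (s.shift μ) ≠ x) ∧ ¬ (blockIter k (s.shift κ) = x ∧ blockIter k ((s.shift κ).shift μ) ≠ x) then ‖w‖ else 0) +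
    (if ¬ (blockIter k s = x ∧ blockIter k (s.shift μ) ≠ x) ∧ (blockIter k (s.shift κ) = x ∧ blockIter k ((s.shift κ).shift μ) ≠ x) then ‖w‖ else 0)
    with hh
  have hgh : ∀ s κ, g s κ ≤ h s κ := fun s κ => by
    simp only [hg, hh]; exact weight_le_indicators _ _ ‖w‖ h2w
  have hgnn : ∀ s κ, 0 ≤ g s κ := by
    intro s κ
    simp only [hg]
    split_ifs <;> positivity
  have hnn : ∀ s κ, 0 ≤ h s κ := fun s κ => (hgnn s κ).trans (hgh s κ)
  -- §2 pointwise
  have hpt : ∀ p : Plaq P 0,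
      ‖adSU2 (GaugeField.plaqHol U₀ p)⁻¹ (X ⟨p.src, p.μ⟩) + adSU2 ((GaugeField.plaqHol U₀ p)⁻¹ * U₀ ⟨p.src, p.μ⟩) (X ⟨p.src.shift p.μ, p.ν⟩) -
        adSU2 ((GaugeField.plaqHol U₀ p)⁻¹ * U₀ ⟨p.src, p.μ⟩ * U₀ ⟨p.src.shift p.μ, p.ν⟩ * (U₀ ⟨p.src.shift p.ν, p.μ⟩)⁻¹) (X ⟨p.src.shift p.ν, p.μ⟩) -
        X ⟨p.src, p.ν⟩‖ ≤ (if p.μ = μ then h p.src p.ν else 0) + (if p.ν = μ then h p.src p.μ else 0) := by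
    intro p
    have h0 : ‖adSU2 (GaugeField.plaqHol U₀ p)⁻¹ (X ⟨p.src, p.μ⟩) + adSU2 ((GaugeField.plaqHol U₀ p)⁻¹ * U₀ ⟨p.src, p.μ⟩) (X ⟨p.src.shift p.μ, p.ν⟩) -
        adSU2 ((GaugeField.plaqHol U₀ p)⁻¹ * U₀ ⟨p.src, p.μ⟩ * U₀ ⟨p.src.shift p.μ, p.ν⟩ * (U₀ ⟨p.src.shift p.ν, p.μ⟩)⁻¹) (X ⟨p.src.shift p.ν, p.μ⟩) -
        X ⟨p.src, p.ν⟩‖ ≤ (if p.μ = μ then g p.src p.ν else 0) + (if p.ν = μ then g p.src p.μ else 0) := by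
      simpa only [hg] using norm_curl_faceSpread_le hk U₀ H x μ hU hW w X hX p
    refine h0.trans (add_le_add ?_ ?_)
    · by_cases hp : p.μ = μ
      · rw [if_pos hp, if_pos hp]; exact hgh p.src p.ν
      · rw [if_neg hp, if_neg hp]
    · by_cases hp : p.ν = μ
      · rw [if_pos hp, if_pos hp]; exact hgh p.src p.μ
      · rw [if_neg hp, if_neg hp]
  refine (Finset.sum_le_sum fun p _ => hpt p).trans ?_
  rw [Finset.sum_add_distrib]
  -- §3a each of the two sums reindexes injectively into `T := univ ×ˢ (univ.erase μ)`
  set T : Finset (Site P 0 × Fin P.d) := univ ×ˢ (univ.erase μ) with hT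
  have hTsum : ∑ t ∈ T, h t.1 t.2 = ∑ κ ∈ univ.erase μ, ∑ s : Site P 0, h s κ := by
    rw [hT, Finset.sum_product, Finset.sum_comm]
  have hA : ∑ p : Plaq P 0, (if p.μ = μ then h p.src p.ν else 0) ≤ ∑ t ∈ T, h t.1 t.2 := by
    rw [← Finset.sum_filter]
    have hinj : Set.InjOn (fun p : Plaq P 0 => (p.src, p.ν)) ↑(univ.filter fun p : Plaq P 0 => p.μ = μ) := by
      rintro ⟨s, a, b, hab⟩ hp ⟨s', a', b', hab'⟩ hp' hpp
      simp only [coe_filter, Set.mem_setOf_eq, mem_univ, true_and, Prod.mk.injEq] at hp hp' hpp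
      obtain ⟨rfl, rfl⟩ := hpp
      subst hp; subst hp'
      rfl
    rw [← Finset.sum_image (f := fun t : Site P 0 × Fin P.d => h t.1 t.2) hinj]
    refine Finset.sum_le_sum_of_subset_of_nonneg ?_ (fun t _ _ => hnn t.1 t.2)
    intro t ht
    simp only [mem_image, mem_filter, mem_univ, true_and] at ht
    obtain ⟨p, hpμ, rfl⟩ := ht
    simp only [hT, mem_product, mem_univ, mem_erase, true_and, and_true]
    rw [← hpμ]; exact ne_of_gt p.hμν
  have hB : ∑ p : Plaq P 0, (if p.ν = μ then h p.src p.μ else 0) ≤ ∑ t ∈ T, h t.1 t.2 := by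
    rw [← Finset.sum_filter]
    have hinj : Set.InjOn (fun p : Plaq P 0 => (p.src, p.μ)) ↑(univ.filter fun p : Plaq P 0 => p.ν = μ) := by
      rintro ⟨s, a, b, hab⟩ hp ⟨s', a', b', hab'⟩ hp' hpp
      simp only [coe_filter, Set.mem_setOf_eq, mem_univ, true_and, Prod.mk.injEq] at hp hp' hpp
      obtain ⟨rfl, rfl⟩ := hpp
      subst hp; subst hp'
      rfl
    rw [← Finset.sum_image (f := fun t : Site P 0 × Fin P.d => h t.1 t.2) hinj]
    refine Finset.sum_le_sum_of_subset_of_nonneg ?_ (fun t _ _ => hnn t.1 t.2)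
    intro t ht
    simp only [mem_image, mem_filter, mem_univ, true_and] at ht
    obtain ⟨p, hpμ, rfl⟩ := ht
    simp only [hT, mem_product, mem_univ, mem_erase, true_and, and_true]
    rw [← hpμ]; exact ne_of_lt p.hμν
  -- §3b the per-direction count
  have hN : (0 : ℝ) ≤ (P.L : ℝ) ^ k := by positivity
  have hκsum : ∀ κ ∈ univ.erase μ, ∑ s : Site P 0, h s κ ≤
      2 * (θ₀ + δI) * ‖w‖ * ((P.L : ℝ) ^ k) ^ (P.d - 1) + ‖w‖ * ((P.L : ℝ) ^ k) ^ (P.d - 2) + ‖w‖ * ((P.L : ℝ) ^ k) ^ (P.d - 2) := by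
    intro κ hκ
    have hκμ : κ ≠ μ := (mem_erase.1 hκ).1
    simp only [hh]
    rw [Finset.sum_add_distrib, Finset.sum_add_distrib, sum_ite_const_eq_card_mul, sum_ite_const_eq_card_mul, sum_ite_const_eq_card_mul]
    have c1 := card_layer_le hk' x μ
    have c2 := card_perimeter_out_le hk x hκμ
    have c3 := card_perimeter_in_le hk x hκμ
    have e1 : (((P.L ^ k) ^ (P.d - 1) : ℕ) : ℝ) = ((P.L : ℝ) ^ k) ^ (P.d - 1) := by push_cast; ring
    have e2 : (((P.L ^ k) ^ (P.d - 2) : ℕ) : ℝ) = ((P.L : ℝ) ^ k) ^ (P.d - 2) := by push_cast; ring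
    refine add_le_add (add_le_add ?_ ?_) ?_
    · refine mul_le_mul_of_nonneg_left ?_ (by positivity)
      rw [← e1]; exact_mod_cast c1
    · refine mul_le_mul_of_nonneg_left ?_ hw0
      rw [← e2]; exact_mod_cast c2
    · refine mul_le_mul_of_nonneg_left ?_ hw0
      rw [← e2]; exact_mod_cast c3
  have hcardκ : ((univ.erase μ).card : ℝ) = (P.d : ℝ) - 1 := by
    rw [card_erase_of_mem (mem_univ μ), card_univ, Fintype.card_fin, Nat.cast_sub P.hd, Nat.cast_one]
  have hTle : ∑ t ∈ T, h t.1 t.2 ≤ ((P.d : ℝ) - 1) *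
      (2 * (θ₀ + δI) * ‖w‖ * ((P.L : ℝ) ^ k) ^ (P.d - 1) + ‖w‖ * ((P.L : ℝ) ^ k) ^ (P.d - 2) + ‖w‖ * ((P.L : ℝ) ^ k) ^ (P.d - 2)) := by
    rw [hTsum, ← hcardκ]
    refine (Finset.sum_le_sum hκsum).trans ?_
    rw [Finset.sum_const, nsmul_eq_mul]
  calc ∑ p : Plaq P 0, (if p.μ = μ then h p.src p.ν else 0) + ∑ p : Plaq P 0, (if p.ν = μ then h p.src p.μ else 0)
      ≤ ∑ t ∈ T, h t.1 t.2 + ∑ t ∈ T, h t.1 t.2 := add_le_add hA hB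
    _ ≤ 2 * (((P.d : ℝ) - 1) *
      (2 * (θ₀ + δI) * ‖w‖ * ((P.L : ℝ) ^ k) ^ (P.d - 1) + ‖w‖ * ((P.L : ℝ) ^ k) ^ (P.d - 2) + ‖w‖ * ((P.L : ℝ) ^ k) ^ (P.d - 2))) := by linarith
    _ = 4 * ((P.d : ℝ) - 1) * (((P.L : ℝ) ^ k) ^ (P.d - 2) + (θ₀ + δI) * ((P.L : ℝ) ^ k) ^ (P.d - 1)) * ‖w‖ := by ring

end Count

end Summit.QuantumFields.YangMills.Theorems.FluctuationComparisonRegPrIntLS2BetaFaceSpreadCurlCount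

end
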